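import Literature.Analysis.FluidPDE.AxisymNoSwirlCoSignedFlux
import HarnessLib

/-!
# SwirlFreeBudget, crux K-18.1 `EtaMoserBound`, step A.2: the axis term of the `L^{2m}` energy
# identity for `η = ω_θ/r` has the GOOD sign (seat nsreg-p4 g13)

Support file for the DORMANT route `SwirlThreshold` (crux stmt-NavierStokesRegularity-2002) and
planner nsreg-p2's ROUND-18 Appendix A (`R18-APPENDIX-EtaMoser.md`, §A.2: "the extra term,
integrated in `r` FIRST: `−∫∫(2/r)∂_r(|η|^{2m}) φ² r dr dθ dz = +4π∫∫|η|^{2m}_{r=0}φ² dz ds +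
∫∫|η|^{2m}(2/r)∂_r(φ²)`; the axis integral is `≥ 0` and is DISCARDED").  In the tree's smooth
vocabulary (`radDerivQuot S = (∂ᵣS)/r`, the smooth radial derivative quotient; cylindrical Fubini
`IsAxisymmetricScalar.integral_eq`; the ray lemmas of `AxisymNoSwirlCoSignedFlux`, whose
`IsAxisymmetricScalar.integral_deriv_comp_mul_radDerivQuot_nonpos` is the UNWEIGHTED case
`Ψ ≡ 1` on `L²`), this file proves the weighted version that the localised energy method needs:

* `integral_nonpos_of_ray_hasDerivAt` — if `G` is an integrable axisymmetric scalar and on every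
  meridian ray `ρ ↦ (ρ, 0, z)` one has `ρ · G = d/dρ Φ` for a compactly supported `Φ` with
  `Φ(0, 0, z) ≥ 0`, then `∫ G dx = −c₂ ∫ Φ(0,0,z) dz ≤ 0`;
* `integral_deriv_comp_mul_radDerivQuot_mul_le` — **the weighted axis term**: for an axisymmetric
  scalar `f ∈ C²`, a profile `H ∈ C¹` with `H ≥ 0`, and a compactly supported axisymmetric weight
  `Ψ ∈ C¹`, `Ψ ≥ 0`, whose radial derivative quotient is `q` (`x₀ q = ∂₀Ψ`):
  `∫ H'(f) · radDerivQuot f · Ψ dx ≤ −∫ H(f) · q dx`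
  (on each ray `ρ(H'(f) q_f Ψ + H(f) q) = ∂_ρ(H(f)Ψ)`, so the sum integrates to
  `−c₂∫ H(f(0,0,z))Ψ(0,0,z) dz ≤ 0` — Feng–Šverák's `4π∫[η^p]_{r=0} dz ≥ 0`, arXiv:1301.6317
  p. 12, with a weight).  With `H(η) = |η|^{2m}`, `Ψ = φ²` this is memo (A.2)'s
  `2∫ H'(η) q_η φ² ≤ −2∫ |η|^{2m} q_{φ²}`, `q_{φ²} = (1/r)∂ᵣ(φ²)`.

WHAT THIS IS NOT: not NS regularity — calculus (an integration by parts on rays); `EtaMoserBound`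
stays OPEN here; no crux claim.
-/

-- the problem directory repeats the summit name (D-0017); core's `dupNamespace` linter fires
set_option linter.dupNamespace false

namespace Summit.NavierStokesRegularity.NavierStokesRegularity.Theorems.SwirlFreeBudget

open MeasureTheory Set Filter Topology Metric Function
open scoped RealInnerProductSpace ContDiff
open Literature.Analysis Literature.Analysis.FluidPDE

noncomputable section

/-- **An integrable axisymmetric scalar which is a ray derivative of a compactly supported
function, nonnegative on the axis, has nonpositive integral.**  If `G` is axisymmetric and
integrable on `ℝ³`, `Φ` has compact support with `Φ(0,0,z) ≥ 0`, and on every meridian ray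
`d/dρ Φ(ρ,0,z) = ρ G(ρ,0,z)`, then `∫ G ≤ 0`: by cylindrical Fubini
`∫ G = ∫ dz c₂ ∫₀^∞ ρ G(ρ,0,z) dρ = ∫ dz c₂ (0 − Φ(0,0,z)) ≤ 0` (fundamental theorem of calculus
on `(0, ∞)`, `Φ` vanishing for large `ρ`). -/
theorem integral_nonpos_of_ray_hasDerivAt {G Φ : EuclideanSpace ℝ (Fin 3) → ℝ}
    (hG : IsAxisymmetricScalar G) (hGi : Integrable G) (hΦc : HasCompactSupport Φ)
    (hΦ0 : ∀ z : ℝ, 0 ≤ Φ (meridianPoint (0, z)))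
    (hderiv : ∀ z ρ : ℝ, HasDerivAt (fun ρ : ℝ => Φ (meridianPoint (ρ, z)))
      (ρ * G (meridianPoint (ρ, z))) ρ) :
    ∫ x, G x ≤ 0 := by
  -- `Φ` vanishes outside a ball
  obtain ⟨R₀, hR₀⟩ := (hΦc.isCompact.isBounded).subset_closedBall (0 : EuclideanSpace ℝ (Fin 3))
  have hzero : ∀ z ρ : ℝ, R₀ < ρ → Φ (meridianPoint (ρ, z)) = 0 := by
    intro z ρ hρ
    apply image_eq_zero_of_notMem_tsupport
    intro hmem
    have h1 : ‖meridianPoint (ρ, z)‖ ≤ R₀ := by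
      have := hR₀ hmem
      rwa [mem_closedBall, dist_zero_right] at this
    have h2 : |ρ| ≤ ‖meridianPoint (ρ, z)‖ := by
      have := PiLp.norm_apply_le (meridianPoint (ρ, z)) (0 : Fin 3)
      simpa using this
    have h3 : ρ ≤ |ρ| := le_abs_self ρ
    linarith
  rw [hG.integral_eq hGi]
  apply integral_nonpos
  intro z
  -- the ray integral is `0 − Φ(0,0,z) ≤ 0` whenever the profile is integrable, else `0`
  by_cases hz : IntegrableOn (fun ρ : ℝ => ρ * G (meridianPoint (ρ, z))) (Ioi 0)
  · have htend : Tendsto (fun ρ : ℝ => Φ (meridianPoint (ρ, z))) atTop (𝓝 0) := by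
      refine tendsto_const_nhds.congr' ?_
      filter_upwards [Ioi_mem_atTop R₀] with ρ hρ
      exact (hzero z ρ hρ).symm
    have hFTC := integral_Ioi_of_hasDerivAt_of_tendsto' (a := 0) (fun ρ _ => hderiv z ρ) hz htend
    have hle : ∫ ρ in Ioi (0 : ℝ), ρ • G (meridianPoint (ρ, z)) ≤ 0 := by
      simp only [smul_eq_mul]
      rw [hFTC]
      linarith [hΦ0 z]
    simp only [Pi.zero_apply, smul_eq_mul]
    exact mul_nonpos_of_nonneg_of_nonpos radialConst₂_pos.le (by simpa only [smul_eq_mul] using hle)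
  · simp only [Pi.zero_apply, smul_eq_mul]
    rw [integral_undef hz, mul_zero]

/-- **The weighted axis term of the energy identity for `η` has the good sign** (memo A.2; the
weighted form of Feng–Šverák's `4π∫[η^p]_{r=0} dz ≥ 0`).  For an axisymmetric scalar `f ∈ C²`
(so that `x₀ · radDerivQuot f = ∂₀ f`), a profile `H ∈ C¹` with `H ≥ 0`, and an axisymmetric
weight `Ψ ∈ C¹` with compact support, `Ψ ≥ 0`, whose radial derivative quotient is the axisymmetric
scalar `q` (`x₀ q(x) = ∂₀Ψ(x)`): if `H'(f) radDerivQuot f Ψ` and `H(f) q` are integrable, then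
`∫ H'(f x) · radDerivQuot f x · Ψ x dx ≤ −∫ H(f x) · q x dx`
(the sum equals `−c₂ ∫ H(f(0,0,z)) Ψ(0,0,z) dz ≤ 0`). -/
theorem integral_deriv_comp_mul_radDerivQuot_mul_le {f : EuclideanSpace ℝ (Fin 3) → ℝ}
    (hf : ContDiff ℝ 2 f) (hfax : IsAxisymmetricScalar f) {H : ℝ → ℝ} (hH : ContDiff ℝ 1 H)
    (hH0 : ∀ v, 0 ≤ H v) {Ψ q : EuclideanSpace ℝ (Fin 3) → ℝ} (hΨ : ContDiff ℝ 1 Ψ)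
    (hΨc : HasCompactSupport Ψ) (hΨ0 : ∀ x, 0 ≤ Ψ x) (hΨax : IsAxisymmetricScalar Ψ)
    (hqax : IsAxisymmetricScalar q)
    (hq : ∀ x : EuclideanSpace ℝ (Fin 3), x 0 * q x = fderiv ℝ Ψ x (EuclideanSpace.single 0 1))
    (hi1 : Integrable fun x => deriv H (f x) * radDerivQuot f x * Ψ x)
    (hi2 : Integrable fun x => H (f x) * q x) :
    ∫ x, deriv H (f x) * radDerivQuot f x * Ψ x ≤ -∫ x, H (f x) * q x := by
  -- the sum `G = H'(f) q_f Ψ + H(f) q` and the ray primitive `Φ = H(f) Ψ`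
  have hfd : Differentiable ℝ f := hf.differentiable two_ne_zero
  have hHd : Differentiable ℝ H := hH.differentiable one_ne_zero
  have hΨd : Differentiable ℝ Ψ := hΨ.differentiable one_ne_zero
  have hGax : IsAxisymmetricScalar fun x => deriv H (f x) * radDerivQuot f x * Ψ x + H (f x) * q x := by
    intro θ x
    simp only [hfax θ x, hΨax θ x, hqax θ x, isAxisymmetricScalar_radDerivQuot hf hfax θ x]
  have hΦc : HasCompactSupport fun x => H (f x) * Ψ x := hΨc.mul_left
  have hΦ0 : ∀ z : ℝ, 0 ≤ H (f (meridianPoint (0, z))) * Ψ (meridianPoint (0, z)) :=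
    fun z => mul_nonneg (hH0 _) (hΨ0 _)
  have hderiv : ∀ z ρ : ℝ, HasDerivAt (fun ρ : ℝ => H (f (meridianPoint (ρ, z))) * Ψ (meridianPoint (ρ, z)))
      (ρ * (deriv H (f (meridianPoint (ρ, z))) * radDerivQuot f (meridianPoint (ρ, z)) *
        Ψ (meridianPoint (ρ, z)) + H (f (meridianPoint (ρ, z))) * q (meridianPoint (ρ, z)))) ρ := by
    intro z ρ
    have hline := hasDerivAt_meridianPoint_fst ρ z
    have hfl : HasDerivAt (fun ρ : ℝ => f (meridianPoint (ρ, z)))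
        (fderiv ℝ f (meridianPoint (ρ, z)) (EuclideanSpace.single 0 1)) ρ :=
      (hfd _).hasFDerivAt.comp_hasDerivAt ρ hline
    have hHfl : HasDerivAt (fun ρ : ℝ => H (f (meridianPoint (ρ, z))))
        (deriv H (f (meridianPoint (ρ, z))) * fderiv ℝ f (meridianPoint (ρ, z)) (EuclideanSpace.single 0 1)) ρ :=
      (hHd _).hasDerivAt.comp ρ hfl
    have hΨl : HasDerivAt (fun ρ : ℝ => Ψ (meridianPoint (ρ, z)))
        (fderiv ℝ Ψ (meridianPoint (ρ, z)) (EuclideanSpace.single 0 1)) ρ :=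
      (hΨd _).hasFDerivAt.comp_hasDerivAt ρ hline
    refine (hHfl.mul hΨl).congr_deriv ?_
    have e1 := mul_radDerivQuot_eq_fderiv_zero hf hfax (meridianPoint (ρ, z))
    have e2 := hq (meridianPoint (ρ, z))
    rw [meridianPoint_apply_zero] at e1 e2
    simp only at e1 e2
    rw [← e1, ← e2]
    ring
  have key := integral_nonpos_of_ray_hasDerivAt hGax (hi1.add hi2) hΦc hΦ0 hderiv
  rw [integral_add hi1 hi2] at key
  linarith

end

end Summit.NavierStokesRegularity.NavierStokesRegularity.Theorems.SwirlFreeBudget
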